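/-
Copyright (c) 2026 the pub-hodgecm-mathlib formalisation cell (harness21).  Prover seat hodgecm-mathlib-LH10-p01 (g3): line LH4 (dyadic pay-down of `stub_N6nsDyadic`),
organ (D-SH), WILD road, brick ‹U-FIN-wild› (W-c) (LH4-plan (g3) DEALER WORD #12); §0∕§1∕§3∕§4 bodies are ★ p849177's (LH5-p02 (g2)) verbatim; 2026-09-02.
-/
import Literature.NumberTheory.Rogawski1990.UnipotentLevelPiecesFrameCM                  -- ★ p846498 (F0P3a-p08): the `ψ = T·e(·)·T⁻¹` dictionary (`conj_localNonsplitEquiv_mem`, `conjClasses_mk_eq_iff_exists_conj`, `conj_localNonsplitEquiv_sub_one_pow_eq_zero`)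
import Literature.NumberTheory.Automorphic.UnitaryThreeRegularUnipotentClass             -- ★ (F0P3a-p08): Prop. 3.9.1 `exists_conj_eq_of_regular_unipotent` (ONE regular class, `2 ≠ 0` in the FIELD)
import Literature.NumberTheory.Automorphic.UnitaryThreeUnipotentConjugacy                -- ★ `exists_conj_coe_eq_cornerUnipotent_of_sq_eq_zero` (square-zero ⇒ conjugate to `n(t)`, `t` skew)
import Literature.NumberTheory.Automorphic.UnitaryThreeSingularUnipotentClasses          -- ★ `exists_conj_eq_iff_exists_norm_mul` (`n(t) ∼ n(t′) ↔ t′ ∈ N(E^×)·t`)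
import Literature.NumberTheory.Automorphic.UnitaryThreeUnipotentClassesUnramified        -- ★ `exists_units_coe_eq_cornerUnipotent'`
import Literature.NumberTheory.LocalFields.QuadraticNormIndexFiniteCM                   -- ★ (W-b) p850190 (this seat): `exists_finset_skew_mod_norms` (finitely many skew norm classes, every place)
import Literature.NumberTheory.LocalFields.CompleteValuedSquareRootNearOne            -- ★ (W-a) p850199 (LH5-p03 (g2)): `exists_mul_self_eq_of_valued_sub_one_lt_four_adicCompletion` (ED. 2)
import HarnessLib

/-!
# ‹U-FIN› at EVERY non-split place `v` of `L⁺` (odd, dyadic, inert, ramified alike): the unipotent conjugacy classes of `G = U(Φ₃)(L⁺_v)` form a FINITE set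
(Rogawski 1990, §3.9 Proposition 3.9.1 p. 32: the classes `1`, `[n(t)]` with `t ∈ (E⁰ ∖ 0) ∕ N E^×`, and ONE regular class) — modulo «deep one-units are squares»

Topic `NumberTheory/Rogawski1990`; namespace `Literature.NumberTheory.Rogawski1990`.  THEOREMS ONLY (no definition, no instance, no notation, no named fact, no `sorry`);
kernel lane `--supports stmt-HodgeConjecture-24833`.  Cell `pub/hodgecm-mathlib` (D-0151), crux H413 = `stmt-HodgeConjecture-24833`; half A line LH4, the DYADIC pay-down of the
closer row `stub_N6nsDyadic` (leaf `Cruxes/H413/Lines/F0_P3c_DyadicPaydown.lean` ED. 1, LH4-plan (g3)), organ (D-SH) «Shalika at `Φ₃` at dyadic non-split places», WILD road,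
brick ‹U-FIN-wild› (W-c) (census `F0/P3c/LH10/LH10-p01/g3/UFIN-WILD-CENSUS.md` b7762a7bdb1a99be).  = ★ p849177 `unitaryThree_unipotent_conjClasses_finite_odd`
(`UnitaryThreeUnipotentClassesFiniteCM`, LH5-p02 (g2)) with the hypothesis `2 ∈ 𝒪_w^×` DELETED and, in its place, the binder (W-a) «deep one-units of `L_w` are squares»
(`∀ s, v(s − 1) < v 4 → ∃ r, r² = s ∧ v(r − 1) < v 2` — LH5-p03 (g2)'s CM-free brick `exists_mul_self_eq_of_valued_sub_one_lt_four_adicCompletion L w.1`, true at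
every place; the hypothesis-free twin drops it the minute that file is ★).

WHAT CHANGED vs ★ p849177.  §2 no longer splits inert ∕ tame: a square-zero `g ∈ U(σ_w, J₀)` is `1` or conjugate to `n(t′)` with `t′` SKEW (★
`exists_conj_coe_eq_cornerUnipotent_of_sq_eq_zero`, field level), `t′ = z·σz·t` for some `t` in the FINITE set `T` of ★ (W-b) `exists_finset_skew_mod_norms` (every residue
characteristic, every ramification), hence `g ∼ n(t)` (★ `exists_conj_eq_iff_exists_norm_mul`); §3's subsingletons are `{1}`, one per `t ∈ T`, and the regular class (★
`exists_conj_eq_of_regular_unipotent`, `2 ≠ 0` in the FIELD `L_w ⊇ ℚ`); §0∕§1∕§4 are ★ p849177's text.  Exactly WHICH classes occur (`[F^× : N E^×] = 2`, local class field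
theory) is not claimed — the organ owes finiteness only.

* `unitaryThree_unipotent_conjClasses_finite'` — ‹U-FIN› at every non-split place, binder form (`hsq`).
* (ED. 2) **`unitaryThree_unipotent_conjClasses_finite''`** — the HYPOTHESIS-FREE head: ★ p849177's text with `IsUnit (2 : 𝒪[w.1.adicCompletion L]) →` DELETED and nothing else.
HONEST LABEL: HC_CM is proved only modulo the 7 printed citations (2 remaining: hLiu418 = stmt-HodgeConjecture-24832, h413 = stmt-HodgeConjecture-24833) until rung 0 closes;
count-neutral brick of the in-house road of the PRINT organ (D-SH); nothing printed is discharged here.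

## References
* [Rogawski1990] J. D. Rogawski, *Automorphic Representations of Unitary Groups in Three Variables*, Ann. of Math. Stud. 123 (1990), §3.9 Proposition 3.9.1 p. 32;
  §1.10 p. 9 (`n(t)`, `u(x, z)`); §8.1 p. 112.
* [Serre1979] J.-P. Serre, *Local Fields*, GTM 67 (1979), Ch. II §3 (one-units), Ch. V §2–§3 (norm groups of quadratic extensions).
* [PlatonovRapinchuk1994] V. Platonov, A. Rapinchuk, *Algebraic Groups and Number Theory* (1994), §5.1 (`U(J)(F_v) = U(σ_w, J)(E_w)` at a non-split place).
-/

set_option autoImplicit false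

noncomputable section

open scoped Matrix MatrixGroups Classical ValuativeRel Valued
open NumberField IsDedekindDomain Matrix

namespace Literature.NumberTheory.Rogawski1990

open Literature.NumberTheory.Automorphic Literature.NumberTheory.Automorphic.UnitaryGroup Literature.NumberTheory.GaloisRepresentations
open Literature.NumberTheory.Automorphic.HermitianLattice

/-- = ★ `unitaryThree_unipotent_conjClasses_finite_odd` with the hypothesis `2 ∈ 𝒪_w^×` deleted (replaced by the binder «deep one-units of `L_w` are squares», true at every place).
**‹U-FIN› AT EVERY NON-SPLIT PLACE**: for a CM field `L`, a finite place `v` of `L⁺` with ONE place `w` of `L` above it, the conjugacy classes `c` of `G = U(Φ₃)(L⁺_v)` with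
unipotent members (`(γ_c − 1)³ = 0`) form a finite set `S` (`c ∈ S ↔ (γ_c − 1)³ = 0`).  One-place model `ψ : G → U(σ_w, J₀)(L_w)`; singular classes `1`, `[n(t)]` (`t` in the
finite set of skew norm-class representatives ★ `exists_finset_skew_mod_norms`); one regular class. [cite: Rogawski1990, §3.9 Prop. 3.9.1 p. 32] [cite: Serre1979, Ch. V §3 Cor. 2]
[cite: PlatonovRapinchuk1994, §5.1] -/
theorem unitaryThree_unipotent_conjClasses_finite' :
    ∀ (L : Type) [Field L] [NumberField L] [IsCMField L] (v : HeightOneSpectrum (𝓞 ↥(maximalRealSubfield L))) (w : UnitaryGroup.PlacesOver L v),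
      Subsingleton (UnitaryGroup.PlacesOver L v) →
      (∀ s : w.1.adicCompletion L, Valued.v (s - 1) < Valued.v (4 : w.1.adicCompletion L) →
        ∃ r : w.1.adicCompletion L, r * r = s ∧ Valued.v (r - 1) < Valued.v (2 : w.1.adicCompletion L)) →
      ∃ S : Finset (ConjClasses ((cmDatum L 3 (Matrix.of fun i j : Fin 3 => if i.val + j.val + 1 = 3 then (1 : L) else 0)).Local v)), ∀ c : ConjClasses ((cmDatum L 3 (Matrix.of fun i j : Fin 3 => if i.val + j.val + 1 = 3 then (1 : L) else 0)).Local v),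
        c ∈ S ↔ (((Quotient.out c : ((cmDatum L 3 (Matrix.of fun i j : Fin 3 => if i.val + j.val + 1 = 3 then (1 : L) else 0)).Local v)).val : GL (Fin 3) (UnitaryGroup.LocalRing L v)).val - 1) ^ 3 = 0 := by
  intro L _ _ _ v w hsub hsq
  haveI : Algebra.IsQuadraticExtension ↥(maximalRealSubfield L) L := IsCMField.isQuadraticExtension L
  -- ## 0. the place `w` is fixed by complex conjugation; the local involution `σ_w`; `2 ≠ 0` in `L_w`
  have hw : IsCMField.complexConj L • w.1 = w.1 := smul_placesOver_eq_of_subsingleton L v (IsCMField.complexConj L) hsub w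
  have hcc : IsCMField.complexConj L * IsCMField.complexConj L = 1 := AlgEquiv.ext fun y => IsCMField.complexConj_apply_apply L y
  have hσσ : ∀ x : w.1.adicCompletion L, galAdicCompletionMap (L := L) (IsCMField.complexConj L) hw (galAdicCompletionMap (L := L) (IsCMField.complexConj L) hw x) = x :=
    galAdicCompletionMap_galAdicCompletionMap_of_smul_eq (IsCMField.complexConj L) w (IsCMField.complexConj_ne_one L) hw
  haveI : CharZero (w.1.adicCompletion L) := charZero_of_injective_algebraMap (algebraMap L _).injective
  have h2K : (2 : w.1.adicCompletion L) ≠ 0 := two_ne_zero  -- field level: the ONLY use of `2` left (the regular class)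
  -- ## 1. the one-place model `ψ = e : G → U(σ_w, J₀)(L_w)` (★ FILE 2a with the frame `T = 1`: `Φ₃ ⊗ 1 = J₀`)
  obtain ⟨ψ, hψ⟩ : ∃ ψ : (cmDatum L 3 (Matrix.of fun i j : Fin 3 => if i.val + j.val + 1 = 3 then (1 : L) else 0)).Local v → GL (Fin 3) (w.1.adicCompletion L), ∀ y, ψ y =
      (1 : GL (Fin 3) (w.1.adicCompletion L)) * ((localNonsplitEquiv (IsCMField.complexConj L) (Matrix.of fun i j : Fin 3 => if i.val + j.val + 1 = 3 then (1 : L) else 0)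
        (IsCMField.complexConj_ne_one L) w hw y :
        ↥(unitaryGroupOfForm (galAdicCompletionMap (L := L) (IsCMField.complexConj L) hw) (placeForm (Matrix.of fun i j : Fin 3 => if i.val + j.val + 1 = 3 then (1 : L) else 0) w.1))) :
          GL (Fin 3) (w.1.adicCompletion L)) * (1 : GL (Fin 3) (w.1.adicCompletion L))⁻¹ :=
    ⟨_, fun _ => rfl⟩
  have hT : placeForm (Matrix.of fun i j : Fin 3 => if i.val + j.val + 1 = 3 then (1 : L) else 0) w.1 =
      formCongr (galAdicCompletionMap (L := L) (IsCMField.complexConj L) hw) (1 : GL (Fin 3) (w.1.adicCompletion L)) ((StdForm.antidiagonal 3).over (w.1.adicCompletion L)) := by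
    simp only [formCongr, placeForm, Units.val_one, Matrix.map_one _ (map_zero _) (map_one _), Matrix.transpose_one, Matrix.one_mul, Matrix.mul_one, antidiagOne_map]
    exact antidiagOne_eq_over (w.1.adicCompletion L) 3
  have hψU : ∀ y, ψ y ∈ unitaryGroupOfForm (galAdicCompletionMap (L := L) (IsCMField.complexConj L) hw) ((StdForm.antidiagonal 3).over (w.1.adicCompletion L)) :=
    fun y => by rw [hψ]; exact conj_localNonsplitEquiv_mem L _ v w hw hT y
  have hψconj : ∀ y y', ConjClasses.mk y = ConjClasses.mk y' ↔
      ∃ k : GL (Fin 3) (w.1.adicCompletion L), k ∈ unitaryGroupOfForm (galAdicCompletionMap (L := L) (IsCMField.complexConj L) hw)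
        ((StdForm.antidiagonal 3).over (w.1.adicCompletion L)) ∧ k * ψ y * k⁻¹ = ψ y' :=
    fun y y' => by simp only [hψ]; exact conjClasses_mk_eq_iff_exists_conj L _ v w hw hT y y'
  have hψnil : ∀ y : (cmDatum L 3 (Matrix.of fun i j : Fin 3 => if i.val + j.val + 1 = 3 then (1 : L) else 0)).Local v,
      (((y.val : GL (Fin 3) (UnitaryGroup.LocalRing L v)).val - 1) ^ 3) = 0 →
      (((ψ y : GL (Fin 3) (w.1.adicCompletion L)) : Matrix (Fin 3) (Fin 3) (w.1.adicCompletion L)) - 1) ^ 3 = 0 :=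
    fun y hy => by rw [hψ]; exact conj_localNonsplitEquiv_sub_one_pow_eq_zero L _ v w hw hy
  have hout : ∀ c : ConjClasses ((cmDatum L 3 (Matrix.of fun i j : Fin 3 => if i.val + j.val + 1 = 3 then (1 : L) else 0)).Local v),
      ConjClasses.mk (Quotient.out c) = c := fun c => by
    rw [← ConjClasses.quotient_mk_eq_mk, Quotient.out_eq]
  -- ## 2. the singular classes: `1` or conjugate to a corner unipotent `n(t)`, `t` in the FINITE set `T` of skew norm-class representatives (★ (W-b), every place)
  obtain ⟨T, hT, hTrep⟩ := Literature.NumberTheory.LocalFields.exists_finset_skew_mod_norms L v w hw hsq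
  have hnTex : ∀ t : (w.1.adicCompletion L), ∃ n : GL (Fin 3) (w.1.adicCompletion L), (n : Matrix (Fin 3) (Fin 3) (w.1.adicCompletion L)) = !![1, 0, t; 0, 1, 0; 0, 0, 1] :=
    fun t => exists_units_coe_eq_cornerUnipotent' t
  choose nT hnT using hnTex
  have hsing : ∀ g : GL (Fin 3) (w.1.adicCompletion L), g ∈ unitaryGroupOfForm (galAdicCompletionMap (L := L) (IsCMField.complexConj L) hw) ((StdForm.antidiagonal 3).over (w.1.adicCompletion L)) →
      ((g : Matrix (Fin 3) (Fin 3) (w.1.adicCompletion L)) - 1) * ((g : Matrix (Fin 3) (Fin 3) (w.1.adicCompletion L)) - 1) = 0 →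
      g = 1 ∨ ∃ t ∈ T, ∃ k : GL (Fin 3) (w.1.adicCompletion L), k ∈ unitaryGroupOfForm (galAdicCompletionMap (L := L) (IsCMField.complexConj L) hw) ((StdForm.antidiagonal 3).over (w.1.adicCompletion L)) ∧ k * g * k⁻¹ = nT t := by
    intro g hg hsq2
    obtain ⟨k, hk, t', hσt', hshape⟩ := exists_conj_coe_eq_cornerUnipotent_of_sq_eq_zero (galAdicCompletionMap (L := L) (IsCMField.complexConj L) hw) hσσ hg hsq2
    by_cases ht' : t' = 0
    · left
      have h1 : k * g * k⁻¹ = 1 := Units.ext (by rw [hshape, ht', Units.val_one]; ext i j; fin_cases i <;> fin_cases j <;> rfl)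
      calc g = k⁻¹ * (k * g * k⁻¹) * k := by group
        _ = 1 := by rw [h1, mul_one, inv_mul_cancel]
    · right
      have hσt'' : galAdicCompletionMap (L := L) (IsCMField.complexConj L) hw t' = -t' := eq_neg_of_add_eq_zero_left hσt'
      obtain ⟨t, htT, z, hz0, ht'eq⟩ := hTrep t' hσt'' ht'
      have ht0 : t ≠ 0 := (hT t htT).2
      obtain ⟨k', hk', hconj⟩ := (exists_conj_eq_iff_exists_norm_mul (galAdicCompletionMap (L := L) (IsCMField.complexConj L) hw) hσσ ht0 (hnT t) hshape).2 ⟨z, hz0, ht'eq⟩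
      exact ⟨t, htT, k'⁻¹ * k, mul_mem (inv_mem hk') hk, by rw [show k'⁻¹ * k * g * (k'⁻¹ * k)⁻¹ = k'⁻¹ * (k * g * k⁻¹) * k' by group, ← hconj]; group⟩
  -- ## 3. the subsingletons of `ConjClasses G`: `{1}`, one per `t ∈ T`, and the regular class
  have hA1 : Set.Subsingleton {c : ConjClasses ((cmDatum L 3 (Matrix.of fun i j : Fin 3 => if i.val + j.val + 1 = 3 then (1 : L) else 0)).Local v) |
      ψ (Quotient.out c) = 1} := by
    intro c hc c' hc'
    simp only [Set.mem_setOf_eq] at hc hc'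
    rw [← hout c, ← hout c', hψconj]
    exact ⟨1, one_mem _, by rw [hc, hc', mul_one, inv_one, mul_one]⟩
  have hAt : ∀ t : (w.1.adicCompletion L), Set.Subsingleton {c : ConjClasses ((cmDatum L 3 (Matrix.of fun i j : Fin 3 => if i.val + j.val + 1 = 3 then (1 : L) else 0)).Local v) |
      ∃ k : GL (Fin 3) (w.1.adicCompletion L), k ∈ unitaryGroupOfForm (galAdicCompletionMap (L := L) (IsCMField.complexConj L) hw) ((StdForm.antidiagonal 3).over (w.1.adicCompletion L)) ∧ k * ψ (Quotient.out c) * k⁻¹ = nT t} := by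
    intro t c hc c' hc'
    obtain ⟨k, hk, hkc⟩ := hc
    obtain ⟨k', hk', hkc'⟩ := hc'
    rw [← hout c, ← hout c', hψconj]
    refine ⟨k'⁻¹ * k, mul_mem (inv_mem hk') hk, ?_⟩
    calc k'⁻¹ * k * ψ (Quotient.out c) * (k'⁻¹ * k)⁻¹ = k'⁻¹ * (k * ψ (Quotient.out c) * k⁻¹) * k' := by group
      _ = k'⁻¹ * (k' * ψ (Quotient.out c') * k'⁻¹) * k' := by rw [hkc, hkc']
      _ = ψ (Quotient.out c') := by group
  have hAr : Set.Subsingleton {c : ConjClasses ((cmDatum L 3 (Matrix.of fun i j : Fin 3 => if i.val + j.val + 1 = 3 then (1 : L) else 0)).Local v) |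
      (((ψ (Quotient.out c) : GL (Fin 3) (w.1.adicCompletion L)) : Matrix (Fin 3) (Fin 3) (w.1.adicCompletion L)) - 1) ^ 3 = 0 ∧
      (((ψ (Quotient.out c) : GL (Fin 3) (w.1.adicCompletion L)) : Matrix (Fin 3) (Fin 3) (w.1.adicCompletion L)) - 1) *
        (((ψ (Quotient.out c) : GL (Fin 3) (w.1.adicCompletion L)) : Matrix (Fin 3) (Fin 3) (w.1.adicCompletion L)) - 1) ≠ 0} := by
    intro c hc c' hc'
    obtain ⟨hn, hr⟩ := hc
    obtain ⟨hn', hr'⟩ := hc'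
    rw [← hout c, ← hout c', hψconj]
    exact exists_conj_eq_of_regular_unipotent (galAdicCompletionMap (L := L) (IsCMField.complexConj L) hw) hσσ h2K (hψU _) (hψU _) ⟨3, hn⟩ ⟨3, hn'⟩ hr hr'
  -- ## 4. the unipotent classes lie in the (finite) union of the subsingletons
  have hfin : Set.Finite {c : ConjClasses ((cmDatum L 3 (Matrix.of fun i j : Fin 3 => if i.val + j.val + 1 = 3 then (1 : L) else 0)).Local v) |
      (((Quotient.out c : ((cmDatum L 3 (Matrix.of fun i j : Fin 3 => if i.val + j.val + 1 = 3 then (1 : L) else 0)).Local v)).val :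
        GL (Fin 3) (UnitaryGroup.LocalRing L v)).val - 1) ^ 3 = 0} := by
    refine ((hA1.finite.union ((T.finite_toSet).biUnion fun t _ => (hAt t).finite)).union hAr.finite).subset ?_
    intro c hc
    have h3 := hψnil _ hc
    simp only [Set.mem_union, Set.mem_setOf_eq, Set.mem_iUnion, exists_prop]
    by_cases hsq2 : (((ψ (Quotient.out c) : GL (Fin 3) (w.1.adicCompletion L)) : Matrix (Fin 3) (Fin 3) (w.1.adicCompletion L)) - 1) *
        (((ψ (Quotient.out c) : GL (Fin 3) (w.1.adicCompletion L)) : Matrix (Fin 3) (Fin 3) (w.1.adicCompletion L)) - 1) = 0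
    · rcases hsing _ (hψU _) hsq2 with h | ⟨t, htT, h⟩
      · exact Or.inl (Or.inl h)
      · exact Or.inl (Or.inr ⟨t, Finset.mem_coe.2 htT, h⟩)
    · exact Or.inr ⟨h3, hsq2⟩
  exact ⟨hfin.toFinset, fun c => by rw [Set.Finite.mem_toFinset, Set.mem_setOf_eq]⟩

/-! ## (ED. 2) The hypothesis-free head: (W-a) is ★ -/

/-- = ★ `unitaryThree_unipotent_conjClasses_finite_odd` with the hypothesis `2 ∈ 𝒪_w^×` deleted — and nothing in its place.
**‹U-FIN› AT EVERY NON-SPLIT PLACE, UNCONDITIONALLY**: for a CM field `L` and a finite place `v` of `L⁺` with ONE place `w` of `L` above it (odd, dyadic, inert, wild alike), the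
conjugacy classes of `U(Φ₃)(L⁺_v)` with unipotent members form a finite set.  `hsq` of `unitaryThree_unipotent_conjClasses_finite'` discharged by ★ p850199
`exists_mul_self_eq_of_valued_sub_one_lt_four_adicCompletion L w.1` (Hensel in `𝒪_w`, LH5-p03 (g2)). [cite: Rogawski1990, §3.9 Prop. 3.9.1 p. 32] [cite: Serre1979, Ch. V §3 Cor. 2] -/
theorem unitaryThree_unipotent_conjClasses_finite'' :
    ∀ (L : Type) [Field L] [NumberField L] [IsCMField L] (v : HeightOneSpectrum (𝓞 ↥(maximalRealSubfield L))) (w : UnitaryGroup.PlacesOver L v),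
      Subsingleton (UnitaryGroup.PlacesOver L v) →
      ∃ S : Finset (ConjClasses ((cmDatum L 3 (Matrix.of fun i j : Fin 3 => if i.val + j.val + 1 = 3 then (1 : L) else 0)).Local v)), ∀ c : ConjClasses ((cmDatum L 3 (Matrix.of fun i j : Fin 3 => if i.val + j.val + 1 = 3 then (1 : L) else 0)).Local v),
        c ∈ S ↔ (((Quotient.out c : ((cmDatum L 3 (Matrix.of fun i j : Fin 3 => if i.val + j.val + 1 = 3 then (1 : L) else 0)).Local v)).val : GL (Fin 3) (UnitaryGroup.LocalRing L v)).val - 1) ^ 3 = 0 :=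
  fun L _ _ _ v w hsub => unitaryThree_unipotent_conjClasses_finite' L v w hsub
    (Literature.NumberTheory.LocalFields.exists_mul_self_eq_of_valued_sub_one_lt_four_adicCompletion L w.1)

end Literature.NumberTheory.Rogawski1990

end
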